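import Literature.AlgebraicGeometry.Resolution.RegularSystemOfParameters
import Mathlib.RingTheory.Regular.Flat
import Mathlib.RingTheory.KrullDimension.Regular
import Mathlib.RingTheory.Localization.AtPrime.Basic
import Mathlib.RingTheory.Localization.Ideal
import Mathlib.RingTheory.Localization.Submodule
import Mathlib.RingTheory.Ideal.Over
import HarnessLib

/-!
# Stub `stub_parameterSubset` for crux stmt-ResolutionOfSingularities-15917
(`RadicialJung.CleanModels`, line `Sketch`)

**Parameters in `q` extend to a regular system of parameters of `O_q`.** Let `O` be a regular
local ring with regular system of parameters `t : Fin d → O` (`(t) = 𝔪`, `d = dim O`), `q` a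
prime, `O'` a localisation of `O` at `q` and `ι : Fin m' ↪ Fin d` indices with `t (ι j) ∈ q`.
Then `𝔪_{O'}` has a generating family `t' : Fin d' → O'`, `d' = dim O'`, whose first `m'`
members are the `t (ι j)`.

Proof. Put `J = (t (ι j))_j ⊆ q`.
* `O/J` is a regular local ring (Matsumura Thm. 14.2, the tree's
  `isRegularLocalRing_quotient_span_image`), so its localisation at `q/J`, which is `O'/J O'`
  (Mathlib: localisation commutes with quotients), is regular (Serre, Matsumura Thm. 19.3, the
  tree's `isRegularLocalRing_localization_atPrime`).
* The `t (ι j)` form an `O`-regular sequence (prefix of a permuted regular system of parameters,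
  the tree's `isRegular_of_span_eq_maximalIdeal`), hence an `O'`-regular sequence (flat base
  change, Mathlib `IsWeaklyRegular.isRegular_of_isLocalization_of_mem`), so
  `dim O'/J O' + m' = dim O'` (Mathlib `ringKrullDim_add_length_eq_ringKrullDim_of_isRegular`).
* Lift a regular system of parameters of `O'/J O'` (`dim O'/J O'` elements) to `O'` and put the
  `t (ι j)` in front: the resulting `dim O'` elements generate `𝔪_{O'}`, the preimage of the
  maximal ideal of `O'/J O'`.
-/

set_option linter.dupNamespace false

open IsLocalRing RingTheory.Sequence
open Literature.AlgebraicGeometry.Resolution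

namespace Summit.ResolutionOfSingularities.ResolutionOfSingularities.Theorems.RadicialJung.CleanModels

/-- A regular local ring `R` has a regular system of parameters: `dim R` elements generating the
maximal ideal (definition of regularity, `emb dim R = dim R`). -/
theorem exists_fin_span_eq_maximalIdeal_ringKrullDim_eq (R : Type*) [CommRing R]
    [IsRegularLocalRing R] :
    ∃ (e : ℕ) (u : Fin e → R), Ideal.span (Set.range u) = maximalIdeal R ∧
      ringKrullDim R = (e : WithBot ℕ∞) := by
  obtain ⟨u, hu⟩ := exists_regularSystemOfParameters (R := R)
  exact ⟨_, u, hu, (IsRegularLocalRing.spanFinrank_maximalIdeal).symm⟩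

/-- **Part of a regular system of parameters is a regular sequence.** If `t : Fin d → O` generates
the maximal ideal of a regular local ring `O` of dimension `d` and `ι : Fin m' → Fin d` is
injective, then `t (ι 0), …, t (ι (m' - 1))` is a weakly `O`-regular sequence: it is a prefix of
the regular system of parameters `t ∘ ι ++ (t i)_{i ∉ im ι}`, an `O`-regular sequence
(Matsumura, Thms. 14.2, 14.3, 17.8). -/
theorem isWeaklyRegular_ofFn_of_span_eq_maximalIdeal {O : Type*} [CommRing O]
    [IsRegularLocalRing O] {d : ℕ} (t : Fin d → O)
    (ht : Ideal.span (Set.range t) = maximalIdeal O) (hd : ringKrullDim O = d) {m' : ℕ}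
    (ι : Fin m' → Fin d) (hι : Function.Injective ι) :
    IsWeaklyRegular O (List.ofFn fun j => t (ι j)) := by
  classical
  -- the complementary indices
  obtain ⟨C, hC⟩ : ∃ C : Finset (Fin d), C = Finset.univ \ Finset.univ.image ι := ⟨_, rfl⟩
  have hCcard : C.card = d - m' := by
    rw [hC, Finset.card_sdiff_of_subset (Finset.subset_univ _), Finset.card_univ,
      Fintype.card_fin, Finset.card_image_of_injective _ hι, Finset.card_univ, Fintype.card_fin]
  have hm'd : m' ≤ d := by simpa using Fintype.card_le_of_injective ι hι
  have hmemC : ∀ i, i ∈ C ↔ ∀ j, ι j ≠ i := by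
    intro i
    simp [hC]
  -- the full list `t ∘ ι ++ (t i)_{i ∈ C}` is a regular system of parameters
  have hset : {r | r ∈ (List.ofFn fun j => t (ι j)) ++ C.toList.map t} = Set.range t := by
    ext r
    simp only [Set.mem_setOf_eq, List.mem_append, List.mem_ofFn', Set.mem_range, List.mem_map,
      Finset.mem_toList]
    constructor
    · rintro (⟨j, rfl⟩ | ⟨i, -, rfl⟩)
      exacts [⟨ι j, rfl⟩, ⟨i, rfl⟩]
    · rintro ⟨i, rfl⟩
      by_cases hi : ∃ j, ι j = i
      · obtain ⟨j, rfl⟩ := hi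
        exact Or.inl ⟨j, rfl⟩
      · exact Or.inr ⟨i, (hmemC i).mpr (fun j h => hi ⟨j, h⟩), rfl⟩
  have hspan : Ideal.ofList ((List.ofFn fun j => t (ι j)) ++ C.toList.map t) = maximalIdeal O := by
    rw [← ht]
    exact congrArg Ideal.span hset
  have hlen : (((List.ofFn fun j => t (ι j)) ++ C.toList.map t).length : WithBot ℕ∞) =
      ringKrullDim O := by
    rw [hd, List.length_append, List.length_ofFn, List.length_map, Finset.length_toList, hCcard,
      Nat.add_sub_of_le hm'd]
  have hreg := isRegular_of_span_eq_maximalIdeal O _ hspan hlen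
  exact ((isWeaklyRegular_append_iff O _ _).mp hreg.toIsWeaklyRegular).1

/-- **Parameters in `q` extend to a regular system of parameters of `O_q`.** Let `O` be a regular
local ring with regular system of parameters `t : Fin d → O` (`(t) = 𝔪`, `d = dim O`), `q` a
prime, `O'` a localisation of `O` at `q`, and `ι : Fin m' ↪ Fin d` indices with `t (ι j) ∈ q`.
Then `𝔪_{O'}` has a generating family `t' : Fin d' → O'`, `d' = dim O'`, whose first `m'`
members are the `t (ι j)` (`O/(t∘ι)` is regular, so its localisation `O'/(t∘ι)` is regular —
Serre —, of dimension `dim O' - m'` as `t ∘ ι` is an `O'`-regular sequence; lift a regular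
system of parameters of it). -/
theorem stub_parameterSubset {O : Type*} [CommRing O] [IsRegularLocalRing O] {d : ℕ}
    (t : Fin d → O) (ht : Ideal.span (Set.range t) = maximalIdeal O) (hd : ringKrullDim O = d)
    (q : Ideal O) [q.IsPrime] {m' : ℕ} (ι : Fin m' → Fin d) (hι : Function.Injective ι)
    (hq : ∀ j, t (ι j) ∈ q) (O' : Type*) [CommRing O'] [IsLocalRing O'] [Algebra O O']
    [IsLocalization.AtPrime O' q] :
    ∃ (d' : ℕ) (hmd : m' ≤ d') (t' : Fin d' → O'),
      Ideal.span (Set.range t') = maximalIdeal O' ∧ ringKrullDim O' = (d' : WithBot ℕ∞) ∧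
      ∀ j : Fin m', t' (Fin.castLE hmd j) = algebraMap O O' (t (ι j)) := by
  classical
  -- the ideal `J = (t (ι j))_j ⊆ q`
  obtain ⟨J, hJ⟩ : ∃ J : Ideal O, J = Ideal.span (Set.range fun j => t (ι j)) := ⟨_, rfl⟩
  have hJq : J ≤ q := by
    rw [hJ, Ideal.span_le]
    rintro _ ⟨j, rfl⟩
    exact hq j
  -- `emb dim O = d`
  have hd' : (maximalIdeal O).spanFinrank = d := by
    have h := IsRegularLocalRing.spanFinrank_maximalIdeal (R := O)
    rw [hd] at h
    exact_mod_cast h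
  -- (1) `O ⧸ J` is a regular local ring (Matsumura Thm. 14.2)
  haveI hOJ : IsRegularLocalRing (O ⧸ J) := by
    have h := isRegularLocalRing_quotient_span_image hd' t ht (Finset.univ.image ι)
    have him : t '' ((Finset.univ.image ι : Finset (Fin d)) : Set (Fin d)) =
        Set.range fun j => t (ι j) := by
      rw [Finset.coe_image, Finset.coe_univ, Set.image_univ, ← Set.range_comp]
      rfl
    rwa [him, ← hJ] at h
  -- (2) the prime `q̄ = q/J` of `O ⧸ J`
  obtain ⟨qb, hqb⟩ : ∃ qb : Ideal (O ⧸ J), qb = q.map (Ideal.Quotient.mk J) := ⟨_, rfl⟩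
  haveI hqbp : qb.IsPrime := by
    rw [hqb]
    exact Ideal.map_isPrime_of_surjective Ideal.Quotient.mk_surjective (by rwa [Ideal.mk_ker])
  have hcomap : qb.comap (Ideal.Quotient.mk J) = q := by
    rw [hqb, Ideal.comap_map_of_surjective' _ Ideal.Quotient.mk_surjective, Ideal.mk_ker]
    exact sup_eq_left.mpr hJq
  -- (3) `O' ⧸ J O'` is the localisation of `O ⧸ J` at `q̄`
  have hM : Algebra.algebraMapSubmonoid (O ⧸ J) q.primeCompl = qb.primeCompl := by
    ext x
    constructor
    · rintro ⟨m, hm, rfl⟩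
      intro hx
      apply hm
      rw [← hcomap]
      exact hx
    · intro hx
      obtain ⟨m, rfl⟩ := Ideal.Quotient.mk_surjective x
      refine ⟨m, fun hm => hx ?_, rfl⟩
      rw [hqb]
      exact Ideal.mem_map_of_mem _ hm
  haveI : IsLocalization.AtPrime (O' ⧸ J.map (algebraMap O O')) qb := by
    show IsLocalization qb.primeCompl (O' ⧸ J.map (algebraMap O O'))
    rw [← hM]
    infer_instance
  -- (4) hence `O' ⧸ J O'` is regular (Serre)
  haveI hreg' : IsRegularLocalRing (O' ⧸ J.map (algebraMap O O')) :=
    haveI := isRegularLocalRing_localization_atPrime (O ⧸ J) qb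
    IsRegularLocalRing.of_ringEquiv
      (Localization.algEquiv qb.primeCompl (O' ⧸ J.map (algebraMap O O'))).toRingEquiv
  -- (5) dimension: `dim O'/J O' + m' = dim O'` (`t ∘ ι` is an `O'`-regular sequence)
  haveI : IsNoetherianRing O' := IsLocalization.isNoetherianRing q.primeCompl O' inferInstance
  have hdim : ringKrullDim (O' ⧸ J.map (algebraMap O O')) + m' = ringKrullDim O' := by
    have hw : IsWeaklyRegular O (List.ofFn fun j => t (ι j)) :=
      isWeaklyRegular_ofFn_of_span_eq_maximalIdeal t ht hd ι hι
    have hr : IsRegular O' ((List.ofFn fun j => t (ι j)).map (algebraMap O O')) :=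
      hw.isRegular_of_isLocalization_of_mem O' q fun r hr => by
        obtain ⟨j, rfl⟩ := (List.mem_ofFn' _ r).mp hr
        exact hq j
    have h := ringKrullDim_add_length_eq_ringKrullDim_of_isRegular _ hr
    rw [List.length_map, List.length_ofFn, ← Ideal.map_ofList] at h
    have hofList : Ideal.ofList (List.ofFn fun j => t (ι j)) = J := by
      rw [hJ]
      exact congrArg Ideal.span (Set.ext fun a => List.mem_ofFn' _ a)
    rwa [hofList] at h
  -- (6) a regular system of parameters of `O' ⧸ J O'` (`dim O' ⧸ J O'` elements), lifted to `O'`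
  obtain ⟨e, u, hu, hdimJ⟩ :=
    exists_fin_span_eq_maximalIdeal_ringKrullDim_eq (O' ⧸ J.map (algebraMap O O'))
  choose v hv using fun k => Ideal.Quotient.mk_surjective (u k)
  have huv : (Ideal.Quotient.mk (J.map (algebraMap O O'))) ∘ v = u := funext hv
  refine ⟨m' + e, Nat.le_add_right _ _, Fin.append (fun j => algebraMap O O' (t (ι j))) v, ?_, ?_,
    fun j => ?_⟩
  · -- `(t ∘ ι, v) = 𝔪_{O'}`
    -- the range of an appended family (`range_fin_append` of `AlterationsEnlargingZ.lean`,
    -- re-proved locally to keep the imports small)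
    have range_fin_append' : ∀ {m n : ℕ} (u : Fin m → O') (v : Fin n → O'),
        Set.range (Fin.append u v) = Set.range u ∪ Set.range v := by
      intro m n u v
      ext x
      constructor
      · rintro ⟨i, rfl⟩
        refine Fin.addCases (fun j => ?_) (fun j => ?_) i
        · exact Or.inl ⟨j, (Fin.append_left u v j).symm⟩
        · exact Or.inr ⟨j, (Fin.append_right u v j).symm⟩
      · rintro (⟨j, rfl⟩ | ⟨j, rfl⟩)
        · exact ⟨Fin.castAdd n j, Fin.append_left u v j⟩
        · exact ⟨Fin.natAdd m j, Fin.append_right u v j⟩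
    have h1 : Ideal.span (Set.range fun j => algebraMap O O' (t (ι j))) =
        J.map (algebraMap O O') := by
      rw [hJ, Ideal.map_span, ← Set.range_comp]
      rfl
    have h2 : (Ideal.span (Set.range v)).map (Ideal.Quotient.mk (J.map (algebraMap O O'))) =
        maximalIdeal (O' ⧸ J.map (algebraMap O O')) := by
      rw [Ideal.map_span, ← Set.range_comp, huv, hu]
    haveI : IsLocalHom (Ideal.Quotient.mk (J.map (algebraMap O O'))) :=
      IsLocalHom.of_surjective _ Ideal.Quotient.mk_surjective
    rw [range_fin_append', Ideal.span_union, h1,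
      ← IsLocalRing.maximalIdeal_comap (Ideal.Quotient.mk (J.map (algebraMap O O'))), ← h2,
      Ideal.comap_map_of_surjective' _ Ideal.Quotient.mk_surjective, Ideal.mk_ker, sup_comm]
  · -- `dim O' = m' + dim O'/J O'`
    rw [← hdim, hdimJ, Nat.cast_add, add_comm]
  · -- the first `m'` members
    rw [Fin.append_left']
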